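import Literature.MathematicalPhysics.KineticTheory.ConfinedFlowReversal
import Literature.Analysis.ODE.ForcedSmoothDependence
import Literature.Analysis.ODE.LiouvilleFormula
import Mathlib.MeasureTheory.Function.Jacobian
import HarnessLib

/-!
# Additive-noise SDEs with a confined drift: the Jacobian of the pathwise flow and Liouville's theorem

Trunk T-KINETIC (Literature/MathematicalPhysics/KineticTheory); theorems only, no named facts.
For the pathwise flow `Φ_t(x) = drivenFlow Y x n t` of `z(t) = x + n(t) + ∫₀ᵗ Y(z)` with a
confined `C¹` drift (`ConfinedForcedFlow.lean`) and a fixed continuous noise path `n`: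

* `ConfinedDrift.exists_hasFDerivAt_flow` — **the time-`t` maps are `C¹` in the initial
  condition, with Jacobian determinant `det DΦ_t(x) = exp ∫₀ᵗ div Y (Φ_s(x)) ds`**
  (`0 ≤ t ≤ T`): differentiability from the implicit-function-theorem treatment of forced
  integral equations (`ForcedSmoothDependence.lean`, after rescaling `[0, T]` to `[0, 1]`), the
  variational equation `DΦ_t = 1 + ∫₀ᵗ DY(Φ_s) DΦ_s ds`, and Liouville's formula
  (`LiouvilleFormula.lean`);
* `ConfinedDrift.exists_hasFDerivAt_flow_of_div_eq` — for a drift of CONSTANT divergence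
  `tr DY ≡ d` the Jacobian is the constant `e^{d t}`;
* `ConfinedDrift.lintegral_comp_flow_mul`, `ConfinedDrift.map_flow_volume` — **Liouville's
  theorem for the driven flow**: `∫ g(Φ_T x) e^{dT} dx = ∫ g` and `(Φ_T)_* Leb = e^{-dT} Leb`
  (change of variables, Mathlib's `lintegral_image_eq_lintegral_abs_det_fderiv_mul`, the map being
  a bijection by `ConfinedFlowReversal.lean`);
* `ConfinedDrift.lintegral_flow_pair_eq` — the form consumed by the duality of transition
  semigroups: `∫ H(x, Φ_T x) dx = e^{-dT} ∫ H(Ψ_T y, y) dy`, `Ψ_T` the reversed flow driven by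
  the reversed noise path.

## References

* V. I. Arnold, *Mathematical Methods of Classical Mechanics* (1978), §16 (Liouville's theorem)
  and *Ordinary Differential Equations* (1992), §27.6.
* P. Hartman, *Ordinary Differential Equations* (1982), Ch. V Thm 3.1 (differentiability in
  initial conditions, variational equation), Ch. IV Thm 1.2 (Liouville's formula). [folklore]
-/

noncomputable section

open MeasureTheory Filter Topology Set Metric Function
open unitInterval hiding symm
open scoped NNReal ENNReal

namespace Literature.MathematicalPhysics.KineticTheory

open Literature.Analysis.ODE

variable {E : Type*} [NormedAddCommGroup E] [NormedSpace ℝ E]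

namespace ConfinedDrift

variable [FiniteDimensional ℝ E] [CompleteSpace E] {Y : E → E} (D : ConfinedDrift Y)
include D

/-! ### The rescaled solution family on `[0, 1]` -/

/-- The flow on `[0, T]` read on the unit interval: `S(x)(τ) = Φ_{Tτ}(x)` as an element of
`C(I, E)`. [folklore] -/
theorem continuous_flow_rescale (x : E) {n : ℝ → E} (hn : Continuous n) (hnS : ∀ t, n t ∈ D.noise)
    (T : ℝ) : Continuous fun τ : I => drivenFlow Y x n (T * τ) :=
  (D.continuous_flow x hn hnS).comp (continuous_const.mul continuous_subtype_val)

/-- **The rescaled flow is the unique zero of the parametric Robbin map** of the drift `T • Y`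
with forcing `g(x) = x + n(T ·)`, and `x ↦ S(x)` is `C¹` (implicit function theorem,
`contDiffAt_forcedSolution_family`), with the variational equation of
`fderiv_forcedSolution_family_apply`. [folklore] -/
theorem exists_rescaledSol {n : ℝ → E} (hn : Continuous n) (hnS : ∀ t, n t ∈ D.noise) {T : ℝ}
    (hT : 0 < T) :
    ∃ (S : E → C(I, E)) (g : E → C(I, E)),
      (∀ x (τ : I), S x τ = drivenFlow Y x n (T * τ)) ∧
      (∀ x (τ : I), g x τ = x + n (T * τ)) ∧
      ContDiff ℝ 1 g ∧ (∀ x, fderiv ℝ g x = ContinuousLinearMap.const ℝ I) ∧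
      (∀ x, forcedRobbinMap (fun y => T • Y y) g (x, S x) = 0) ∧
      (∀ x α, forcedRobbinMap (fun y => T • Y y) g (x, α) = 0 → α = S x) ∧
      ContDiff ℝ 1 S := by
  have hYc : Continuous Y := D.contDiff_drift.continuous
  have hYT : ContDiff ℝ 1 fun y => T • Y y := D.contDiff_drift.const_smul T
  have hYTc : Continuous fun y => T • Y y := hYT.continuous
  -- the forcing
  let nT : C(I, E) := ⟨fun τ => n (T * τ), hn.comp (continuous_const.mul continuous_subtype_val)⟩
  let g : E → C(I, E) := fun x => ContinuousLinearMap.const ℝ I x + nT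
  have hg_apply : ∀ x (τ : I), g x τ = x + n (T * τ) := fun x τ => rfl
  have hg_deriv : ∀ x, HasFDerivAt g (ContinuousLinearMap.const ℝ I (M := E)) x := fun x =>
    (ContinuousLinearMap.const ℝ I (M := E)).hasFDerivAt.add_const nT
  have hg_smooth : ContDiff ℝ 1 g := (ContinuousLinearMap.const ℝ I (M := E)).contDiff.add contDiff_const
  have hg_fderiv : ∀ x, fderiv ℝ g x = ContinuousLinearMap.const ℝ I := fun x => (hg_deriv x).fderiv
  -- the family
  let S : E → C(I, E) := fun x => ⟨fun τ => drivenFlow Y x n (T * τ), D.continuous_flow_rescale x hn hnS T⟩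
  have hS_apply : ∀ x (τ : I), S x τ = drivenFlow Y x n (T * τ) := fun x τ => rfl
  -- `S x` is a zero of the Robbin map
  have hS : ∀ x, forcedRobbinMap (fun y => T • Y y) g (x, S x) = 0 := by
    intro x
    rw [forcedRobbinMap_eq_zero_iff]
    intro τ
    have hTτ : T * (τ : ℝ) ∈ Icc 0 T :=
      ⟨mul_nonneg hT.le τ.2.1, by nlinarith [τ.2.2, hT]⟩
    have hsol := D.isIntegralSolutionOn_flow x hn hnS T (T * τ) hTτ
    rw [hS_apply, hsol, hg_apply]
    congr 1
    -- `∫₀^{Tτ} Y(z) = ∫₀^τ T • Y(z(T s)) ds`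
    have h1 : ∫ s in (0 : ℝ)..(τ : ℝ), IccExtend zero_le_one (nemytskii (fun y => T • Y y) (S x)) s =
        ∫ s in (0 : ℝ)..(τ : ℝ), T • Y (drivenFlow Y x n (T * s)) := by
      refine intervalIntegral.integral_congr fun s hs => ?_
      rw [uIcc_of_le τ.2.1] at hs
      have hs1 : s ∈ Icc (0 : ℝ) 1 := ⟨hs.1, hs.2.trans τ.2.2⟩
      rw [IccExtend_nemytskii_of_mem hYTc (S x) hs1]
      rfl
    rw [h1, intervalIntegral.integral_smul]
    have h2 := intervalIntegral.smul_integral_comp_mul_left (f := fun s => Y (drivenFlow Y x n s))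
      (a := 0) (b := (τ : ℝ)) T
    rw [mul_zero] at h2
    exact h2.symm
  -- uniqueness
  have huniq : ∀ x α, forcedRobbinMap (fun y => T • Y y) g (x, α) = 0 → α = S x := by
    intro x α hα
    rw [forcedRobbinMap_eq_zero_iff] at hα
    -- the candidate solution in real time
    set αe : ℝ → E := fun t => IccExtend zero_le_one α (t / T) with hαe
    have hαc : Continuous αe :=
      (map_continuous α).Icc_extend'.comp (continuous_id.div_const T)
    have hmemI : ∀ {t : ℝ}, t ∈ Icc 0 T → t / T ∈ Icc (0 : ℝ) 1 := fun {t} ht =>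
      ⟨div_nonneg ht.1 hT.le, div_le_one_of_le₀ ht.2 hT.le⟩
    have hαe_of : ∀ {t : ℝ} (ht : t ∈ Icc 0 T), αe t = α ⟨t / T, hmemI ht⟩ := fun {t} ht => by
      rw [hαe]
      exact IccExtend_of_mem zero_le_one α (hmemI ht)
    have hsolα : IsIntegralSolutionOn Y (fun t => x + n t) αe T := by
      intro t ht
      have h1 := hα ⟨t / T, hmemI ht⟩
      rw [hαe_of ht, h1, hg_apply]
      have htT : T * (t / T) = t := mul_div_cancel₀ t hT.ne'
      rw [htT]
      congr 1
      -- `∫₀^{t/T} T • Y(α s) ds = ∫₀ᵗ Y(αe u) du`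
      have h2 : ∫ s in (0 : ℝ)..t / T, IccExtend zero_le_one (nemytskii (fun y => T • Y y) α) s =
          ∫ s in (0 : ℝ)..t / T, T • Y (IccExtend zero_le_one α s) := by
        refine intervalIntegral.integral_congr fun s hs => ?_
        rw [uIcc_of_le (hmemI ht).1] at hs
        have hs1 : s ∈ Icc (0 : ℝ) 1 := ⟨hs.1, hs.2.trans (hmemI ht).2⟩
        rw [IccExtend_nemytskii_of_mem hYTc α hs1, IccExtend_of_mem zero_le_one α hs1]
      rw [h2, intervalIntegral.integral_smul]
      have h3 := intervalIntegral.integral_comp_div (fun s => Y (IccExtend zero_le_one α s))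
        hT.ne' (a := 0) (b := t)
      rw [zero_div] at h3
      rw [← h3]
    have heq := D.eqOn_flow x hn hnS hsolα hαc
    refine ContinuousMap.ext fun τ => ?_
    have hTτ : T * (τ : ℝ) ∈ Icc 0 T :=
      ⟨mul_nonneg hT.le τ.2.1, by nlinarith [τ.2.2, hT]⟩
    have h1 := heq hTτ
    rw [hαe_of hTτ] at h1
    have hτ : (⟨T * τ / T, hmemI hTτ⟩ : I) = τ := by
      apply Subtype.ext
      simp only
      rw [mul_div_cancel_left₀ _ hT.ne']
    rw [hτ] at h1
    rw [hS_apply]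
    exact h1
  have hsmooth : ContDiff ℝ 1 S :=
    contDiff_iff_contDiffAt.2 fun x₀ => contDiffAt_forcedSolution_family hYT hg_smooth le_rfl hS huniq x₀
  exact ⟨S, g, hS_apply, hg_apply, hg_smooth, hg_fderiv, hS, huniq, hsmooth⟩

/-! ### The derivative of the time-`t` map and its determinant -/

/-- **The time-`t` maps of the flow are differentiable in the initial condition, with Jacobian
`exp ∫₀ᵗ div Y` along the trajectory** (`0 ≤ t ≤ T`): there are derivatives `J x t` of
`x ↦ drivenFlow Y x n t` with `det (J x t) = exp (∫₀ᵗ tr DY(drivenFlow Y x n s) ds)`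
(variational equation + Liouville's formula). [folklore] -/
theorem exists_hasFDerivAt_flow {n : ℝ → E} (hn : Continuous n) (hnS : ∀ t, n t ∈ D.noise)
    {T : ℝ} (hT : 0 < T) :
    ∃ J : E → ℝ → E →L[ℝ] E,
      (∀ x, ∀ t ∈ Icc 0 T, HasFDerivAt (fun x => drivenFlow Y x n t) (J x t) x) ∧
      ∀ x, ∀ t ∈ Icc 0 T, (J x t).det =
        Real.exp (∫ s in (0 : ℝ)..t,
          LinearMap.trace ℝ E (fderiv ℝ Y (drivenFlow Y x n s) : E →ₗ[ℝ] E)) := by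
  obtain ⟨S, g, hS_apply, hg_apply, hg_smooth, hg_fderiv, hS, huniq, hsmooth⟩ :=
    D.exists_rescaledSol hn hnS hT
  have hYT : ContDiff ℝ 1 fun y => T • Y y := D.contDiff_drift.const_smul T
  have hSd : ∀ x, HasFDerivAt S (fderiv ℝ S x) x := fun x =>
    ((hsmooth.differentiable one_ne_zero) x).hasFDerivAt
  -- the time parameter on the unit interval
  let pr : ℝ → I := fun t => projIcc 0 1 zero_le_one (t / T)
  have hmemI : ∀ {t : ℝ}, t ∈ Icc 0 T → t / T ∈ Icc (0 : ℝ) 1 := fun {t} ht =>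
    ⟨div_nonneg ht.1 hT.le, div_le_one_of_le₀ ht.2 hT.le⟩
  have hpr : ∀ {t : ℝ} (ht : t ∈ Icc 0 T), pr t = ⟨t / T, hmemI ht⟩ := fun {t} ht =>
    projIcc_of_mem zero_le_one (hmemI ht)
  have hprval : ∀ {t : ℝ} (ht : t ∈ Icc 0 T), ((pr t : I) : ℝ) = t / T := fun {t} ht => by
    rw [hpr ht]
  have hflow : ∀ x, ∀ t ∈ Icc 0 T, drivenFlow Y x n t = S x (pr t) := fun x t ht => by
    rw [hS_apply, hprval ht, mul_div_cancel₀ t hT.ne']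
  -- the derivatives
  let J : E → ℝ → E →L[ℝ] E := fun x t => (ContinuousMap.evalCLM ℝ (pr t)).comp (fderiv ℝ S x)
  have hJ_apply : ∀ x t v, J x t v = fderiv ℝ S x v (pr t) := fun x t v => rfl
  have hderiv : ∀ x, ∀ t ∈ Icc 0 T, HasFDerivAt (fun x => drivenFlow Y x n t) (J x t) x := by
    intro x t ht
    have h := (ContinuousMap.evalCLM ℝ (pr t) (M := E)).hasFDerivAt.comp x (hSd x)
    have heq : (fun x => drivenFlow Y x n t) = fun x => ContinuousMap.evalCLM ℝ (pr t) (S x) := by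
      funext x'
      rw [ContinuousMap.evalCLM_apply, hflow x' t ht]
    rw [heq]
    exact h
  refine ⟨J, hderiv, fun x => ?_⟩
  -- Liouville's formula along the trajectory from `x`
  set A : ℝ → E →L[ℝ] E := fun s => fderiv ℝ Y (drivenFlow Y x n s) with hA_def
  have hAc : Continuous A :=
    (D.contDiff_drift.continuous_fderiv one_ne_zero).comp (D.continuous_flow x hn hnS)
  -- the variational equation in real time
  have hvar : ∀ v, ∀ u ∈ Icc 0 T, J x u v = v + ∫ s in (0 : ℝ)..u, A s (J x s v) := by
    intro v u hu
    rw [hJ_apply]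
    have h := fderiv_forcedSolution_family_apply hYT hg_smooth le_rfl hS huniq x v (pr u)
    rw [h, hg_fderiv, ContinuousLinearMap.const_apply_apply, hprval hu]
    congr 1
    -- the integrand of the variational equation on `[0, 1]`
    set G : ℝ → E := IccExtend zero_le_one
      (applyCLM (nemytskii (fderiv ℝ fun y => T • Y y) (S x)) (fderiv ℝ S x v)) with hG
    have hG_of : ∀ {s : ℝ} (hs : s ∈ Icc 0 T), G (s / T) = T • A s (J x s v) := by
      intro s hs
      rw [hG, IccExtend_applyCLM_nemytskii_fderiv_of_mem hYT le_rfl (S x) (fderiv ℝ S x v) (hmemI hs)]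
      have hTY : fderiv ℝ (fun y => T • Y y) (S x ⟨s / T, hmemI hs⟩) = T • A s := by
        rw [hA_def]
        simp only
        rw [hflow x s hs, hpr hs]
        exact ((D.contDiff_drift.differentiable one_ne_zero _).hasFDerivAt.const_smul T).fderiv
      rw [hTY, hJ_apply, hpr hs]
      rfl
    -- `∫₀^{u/T} G = ∫₀ᵘ A s (J x s v) ds`
    have h3 := intervalIntegral.integral_comp_div G hT.ne' (a := 0) (b := u)
    rw [zero_div] at h3
    have h4 : ∫ s in (0 : ℝ)..u, G (s / T) = ∫ s in (0 : ℝ)..u, T • A s (J x s v) := by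
      refine intervalIntegral.integral_congr fun s hs => ?_
      rw [uIcc_of_le hu.1] at hs
      exact hG_of ⟨hs.1, hs.2.trans hu.2⟩
    rw [h4, intervalIntegral.integral_smul] at h3
    exact (smul_right_injective _ hT.ne' h3).symm
  -- continuity of `s ↦ J x s v`
  have hJc : ∀ v, Continuous fun s => J x s v := fun v => by
    simp only [hJ_apply]
    exact (map_continuous (fderiv ℝ S x v)).comp (continuous_projIcc.comp (continuous_id.div_const T))
  -- right derivatives from the integral equation
  have hJ' : ∀ v, ∀ t ∈ Ico 0 T, HasDerivWithinAt (fun u => J x u v) (A t (J x t v)) (Ici t) t := by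
    intro v t ht
    have hF : ContinuousOn (fun s => A s (J x s v)) (Icc 0 T) :=
      (hAc.clm_apply (hJc v)).continuousOn
    have h1 := hasDerivWithinAt_integral_of_continuousOn hF ht
    have h2 : HasDerivWithinAt (fun u => v + ∫ s in (0 : ℝ)..u, A s (J x s v)) (A t (J x t v))
        (Ici t) t := h1.const_add v
    have h3 : HasDerivWithinAt (fun u => v + ∫ s in (0 : ℝ)..u, A s (J x s v)) (A t (J x t v))
        (Icc t T) t := h2.mono Icc_subset_Ici_self
    have h4 : HasDerivWithinAt (fun u => J x u v) (A t (J x t v)) (Icc t T) t :=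
      h3.congr (fun u hu => hvar v u ⟨ht.1.trans hu.1, hu.2⟩) (hvar v t ⟨ht.1, ht.2.le⟩)
    exact h4.mono_of_mem_nhdsWithin (Icc_mem_nhdsGE ht.2)
  have hJ0 : J x 0 = ContinuousLinearMap.id ℝ E := by
    refine ContinuousLinearMap.ext fun v => ?_
    rw [hvar v 0 ⟨le_rfl, hT.le⟩]
    simp
  exact det_eq_exp_integral_trace hT.le hAc.continuousOn (fun v => (hJc v).continuousOn) hJ' hJ0

/-- **Constant divergence**: if `tr DY ≡ d` then the time-`t` maps have Jacobian `e^{d t}`.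
[folklore] -/
theorem exists_hasFDerivAt_flow_of_div_eq {n : ℝ → E} (hn : Continuous n)
    (hnS : ∀ t, n t ∈ D.noise) {T : ℝ} (hT : 0 < T) {d : ℝ}
    (hdiv : ∀ y, LinearMap.trace ℝ E (fderiv ℝ Y y : E →ₗ[ℝ] E) = d) :
    ∃ J : E → ℝ → E →L[ℝ] E,
      (∀ x, ∀ t ∈ Icc 0 T, HasFDerivAt (fun x => drivenFlow Y x n t) (J x t) x) ∧
      ∀ x, ∀ t ∈ Icc 0 T, (J x t).det = Real.exp (d * t) := by
  obtain ⟨J, hJ, hdet⟩ := D.exists_hasFDerivAt_flow hn hnS hT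
  refine ⟨J, hJ, fun x t ht => ?_⟩
  rw [hdet x t ht]
  simp only [hdiv, intervalIntegral.integral_const, smul_eq_mul, sub_zero, mul_comm]

/-! ### Liouville's theorem for the driven flow (constant divergence) -/

section Measure

variable [MeasurableSpace E] [BorelSpace E] (μ : Measure E) [μ.IsAddHaarMeasure] {Y' : E → E}
  (D' : ConfinedDrift Y')
include D'

/-- **Change of variables under the time-`T` map** (constant divergence `d`, `Y' = -Y` also
confined, noise path starting at `0`): `∫ g(Φ_T x) e^{dT} dμ(x) = ∫ g dμ` for every
`g : E → [0, ∞]` and every additive Haar measure `μ`. [folklore] -/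
theorem lintegral_comp_flow_mul (hY' : ∀ y, Y' y = -Y y) {n : ℝ → E} (hn : Continuous n)
    (hnS : ∀ t, n t ∈ D.noise) (hnS' : ∀ t, n t ∈ D'.noise) (hn0 : n 0 = 0) {T : ℝ} (hT : 0 < T)
    {d : ℝ} (hdiv : ∀ y, LinearMap.trace ℝ E (fderiv ℝ Y y : E →ₗ[ℝ] E) = d) (g : E → ℝ≥0∞) :
    ∫⁻ x, ENNReal.ofReal (Real.exp (d * T)) * g (drivenFlow Y x n T) ∂μ = ∫⁻ y, g y ∂μ := by
  obtain ⟨J, hJ, hdet⟩ := D.exists_hasFDerivAt_flow_of_div_eq hn hnS hT hdiv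
  have hinj : InjOn (fun x => drivenFlow Y x n T) univ :=
    (D.flow_injective D' hY' hn hnS hnS' hn0 hT.le).injOn
  have h := lintegral_image_eq_lintegral_abs_det_fderiv_mul μ MeasurableSet.univ
    (fun x _ => (hJ x T ⟨hT.le, le_rfl⟩).hasFDerivWithinAt) hinj g
  rw [image_univ, D.range_flow_eq_univ D' hY' hn hnS hnS' hn0 hT.le, Measure.restrict_univ] at h
  rw [h]
  refine lintegral_congr fun x => ?_
  rw [hdet x T ⟨hT.le, le_rfl⟩, abs_of_pos (Real.exp_pos _)]

/-- **Liouville's theorem for the driven flow**: under the time-`T` map, Lebesgue measure is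
mapped to `e^{-dT}` times itself, `(Φ_T)_* Leb = e^{-dT} Leb` (phase volume is multiplied by
`e^{dT}`). [folklore] -/
theorem map_flow_volume (hY' : ∀ y, Y' y = -Y y) {n : ℝ → E} (hn : Continuous n)
    (hnS : ∀ t, n t ∈ D.noise) (hnS' : ∀ t, n t ∈ D'.noise) (hn0 : n 0 = 0) {T : ℝ} (hT : 0 < T)
    {d : ℝ} (hdiv : ∀ y, LinearMap.trace ℝ E (fderiv ℝ Y y : E →ₗ[ℝ] E) = d) :
    Measure.map (fun x => drivenFlow Y x n T) μ = ENNReal.ofReal (Real.exp (-(d * T))) • μ := by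
  have hmeas : Measurable fun x => drivenFlow Y x n T := (D.continuous_flow_left hn hnS T).measurable
  refine Measure.ext fun A hA => ?_
  rw [Measure.map_apply hmeas hA, Measure.smul_apply, smul_eq_mul, ← lintegral_indicator_one hA,
    ← lintegral_indicator_one (hmeas hA)]
  have h := D.lintegral_comp_flow_mul μ D' hY' hn hnS hnS' hn0 hT hdiv (A.indicator 1)
  have hind : ∀ x, (A.indicator (1 : E → ℝ≥0∞)) (drivenFlow Y x n T) =
      ((fun x => drivenFlow Y x n T) ⁻¹' A).indicator 1 x := fun x => rfl
  simp_rw [hind] at h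
  rw [lintegral_const_mul' _ _ ENNReal.ofReal_ne_top] at h
  rw [← h, ← mul_assoc, ← ENNReal.ofReal_mul (Real.exp_pos _).le, ← Real.exp_add, neg_add_cancel,
    Real.exp_zero, ENNReal.ofReal_one, one_mul]

/-- **The joint change of variables** behind the duality of the transition semigroups:
`∫ H(x, Φ_T x) dx = e^{-dT} ∫ H(Ψ_T y, y) dy`, where `Ψ_T y = drivenFlow Y' y (reversePath n T) T`
is the reversed flow (the inverse of `Φ_T`). [folklore] -/
theorem lintegral_flow_pair_eq (hY' : ∀ y, Y' y = -Y y) {n : ℝ → E} (hn : Continuous n)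
    (hnS : ∀ t, n t ∈ D.noise) (hnS' : ∀ t, n t ∈ D'.noise) (hn0 : n 0 = 0) {T : ℝ} (hT : 0 < T)
    {d : ℝ} (hdiv : ∀ y, LinearMap.trace ℝ E (fderiv ℝ Y y : E →ₗ[ℝ] E) = d)
    {H : E × E → ℝ≥0∞} (hH : Measurable H) :
    ∫⁻ x, H (x, drivenFlow Y x n T) ∂μ =
      ENNReal.ofReal (Real.exp (-(d * T))) *
        ∫⁻ y, H (drivenFlow Y' y (reversePath n T) T, y) ∂μ := by
  set Φ : E → E := fun x => drivenFlow Y x n T with hΦ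
  set Ψ : E → E := fun y => drivenFlow Y' y (reversePath n T) T with hΨ
  have hΦm : Measurable Φ := (D.continuous_flow_left hn hnS T).measurable
  have hΨm : Measurable Ψ :=
    (D'.continuous_flow_left (continuous_reversePath hn T) (fun s => reversePath_mem hnS' T s) T).measurable
  have hΨΦ : ∀ x, Ψ (Φ x) = x := fun x => D.flow_reverse_apply D' hY' x hn hnS hnS' hn0 hT.le
  -- `H(x, Φ x) = G(Φ x)` with `G y = H(Ψ y, y)`
  set G : E → ℝ≥0∞ := fun y => H (Ψ y, y) with hG
  have hGm : Measurable G := hH.comp (hΨm.prodMk measurable_id)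
  have h1 : (fun x => H (x, Φ x)) = fun x => G (Φ x) := by
    funext x
    simp only [hG, hΨΦ x]
  rw [h1, ← lintegral_map hGm hΦm, D.map_flow_volume μ D' hY' hn hnS hnS' hn0 hT hdiv,
    lintegral_smul_measure, smul_eq_mul]

end Measure

end ConfinedDrift

end Literature.MathematicalPhysics.KineticTheory
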